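import Summits.CriticalPhenomena.PercolationContinuityZ3.Theorems.PercNearOneGluingNoHeavyLowerTailCoinStep
import Summits.CriticalPhenomena.PercolationContinuityZ3.Theorems.PercNearOneGluingNoHeavyLowerTailMergeStability
import HarnessLib

/-!
# `NoHeavyLowerTail` (stmt-CriticalPhenomena-4575) — FREE-EDGE PEELING ⇒ the pattern-lightest bound ⇒ the crux

Support file (prover `prim-hp-8`, PL programme; `--supports stmt-CriticalPhenomena-4575`).  No definitions, no named facts, no sorries.
Notation of `…CoinPatterns.lean` / `…CoinStep.lean`: observer `o ∉ A`, ranking `r` injective on `A` and compatible with lightness in `H`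
(the weights with the pairs at `o` switched off), `Φ_r(v) = Σ_{b∈A} μ_v(Sel_b)·μ_v(R_b) − μ_v(1 ≤ N ≤ j)`.

The COIN STEP `CoinReduction.coinStep` says `Φ_r(v) ≥ (1 − v s(o,c))·Φ_r(v[s(o,c) ↦ 0])` for every relay `c` (a theorem: Lemma M + TOP'').
The same inequality for a NON-relay neighbour `y`,

  `(FP)   Φ_r(v) ≥ (1 − v s(o,y))·Φ_r(v[s(o,y) ↦ 0])`       ("free-edge peeling"),

is census-clean (0 / 2 169 exact instances incl. glued pairs at `o`, memo PROOF-COIN-REDUCTION.md §11; it is equivalent to the conjunction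
of the glue-step inequality `(B*)` of `…FreeEdgeStep.lean` and `Φ_r(v[s(o,y) ↦ 1]) ≥ 0`, because
`Φ_r(v) − (1−u)Φ_r(v⁰) = u·(Φ_r(v¹) + (1−u)·X)` by the one-bond expansion).  Peeling all pairs at `o` one by one gives `Φ_r(v) ≥ 0` outright:

* `patternLightest_of_freePeel` — if (FP) holds for every non-relay `y ≠ o` with `w s(o,y) ≠ 0`, for every `w` agreeing with `v` off the
  pairs at `o`, then `Φ_r(v) ≥ 0` (induction on the number of non-loop pairs at `o` of nonzero weight; base: isolated observer, `μ(L) = 0`).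
* `noHeavyLowerTail_of_freePeel` — typed target: (FP) for all graphs ⇒ `NoHeavyLowerTail`.  ONE local hypothesis, no glued observers.
-/

noncomputable section

namespace Summit.CriticalPhenomena.PercolationContinuityZ3.Theorems

namespace CoinReduction

open MeasureTheory Set Literature.Probability.LatticeModels Literature.Probability.Percolation
open scoped Classical BigOperators

variable {n : ℕ}

/-- **Free-edge peeling ⇒ the pattern-lightest bound.**  `o ∉ A`, `r` injective on `A` and `H`-compatible.  If for every `w` agreeing with
`v` off the pairs at `o` and every non-relay `y ≠ o` with `w s(o,y) ≠ 0` one has `(1 − w s(o,y))·Φ_r(w[s(o,y)↦0]) ≤ Φ_r(w)`, then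
`Φ_r(v) ≥ 0`, i.e. `μ_v(1 ≤ N ≤ j) ≤ Σ_b μ_v(Sel_b)·μ_v(R_b)`. [folklore — peeling: coins by `coinStep`, free pairs by hypothesis] -/
theorem patternLightest_of_freePeel (v : Sym2 (Fin n) → unitInterval) (A : Finset (Fin n)) (j : ℕ) (o : Fin n)
    (r : Fin n → ℕ) (hr : Set.InjOn r ↑A) (hoA : o ∉ A)
    (hcompat : ∀ b ∈ A, ∀ b' ∈ A, r b < r b' →
      (prodBernoulli fun e : Sym2 (Fin n) => if e ∈ {e : Sym2 (Fin n) | o ∉ e} then v e else 0).real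
          {ω : BondConfig (Fin n) | (A.filter fun z => ω ∈ openConn b' z).card ≤ j} ≤
        (prodBernoulli fun e : Sym2 (Fin n) => if e ∈ {e : Sym2 (Fin n) | o ∉ e} then v e else 0).real
          {ω : BondConfig (Fin n) | (A.filter fun z => ω ∈ openConn b z).card ≤ j})
    (hpeel : ∀ (w : Sym2 (Fin n) → unitInterval) (y : Fin n), (∀ e : Sym2 (Fin n), o ∉ e → w e = v e) →
      y ≠ o → y ∉ A → w s(o, y) ≠ 0 →
      (1 - (w s(o, y) : ℝ)) *
          (∑ b ∈ A, (prodBernoulli (Function.update w s(o, y) 0)).real {ω : BondConfig (Fin n) |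
              b ∈ (A.filter fun b' => ω ∈ openConnIn ((↑A : Set (Fin n))ᶜ ∪ {b'}) o b') ∧
              ∀ b' ∈ A, r b' < r b → b' ∉ (A.filter fun b'' => ω ∈ openConnIn ((↑A : Set (Fin n))ᶜ ∪ {b''}) o b'')} *
            (prodBernoulli (Function.update w s(o, y) 0)).real
              {ω : BondConfig (Fin n) | (A.filter fun z => ω ∈ openConn b z).card ≤ j} -
          (prodBernoulli (Function.update w s(o, y) 0)).real {ω : BondConfig (Fin n) |
            1 ≤ (A.filter fun z => ω ∈ openConn o z).card ∧ (A.filter fun z => ω ∈ openConn o z).card ≤ j}) ≤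
        ∑ b ∈ A, (prodBernoulli w).real {ω : BondConfig (Fin n) |
            b ∈ (A.filter fun b' => ω ∈ openConnIn ((↑A : Set (Fin n))ᶜ ∪ {b'}) o b') ∧
            ∀ b' ∈ A, r b' < r b → b' ∉ (A.filter fun b'' => ω ∈ openConnIn ((↑A : Set (Fin n))ᶜ ∪ {b''}) o b'')} *
          (prodBernoulli w).real {ω : BondConfig (Fin n) | (A.filter fun z => ω ∈ openConn b z).card ≤ j} -
        (prodBernoulli w).real {ω : BondConfig (Fin n) |
          1 ≤ (A.filter fun z => ω ∈ openConn o z).card ∧ (A.filter fun z => ω ∈ openConn o z).card ≤ j}) :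
    (prodBernoulli v).real {ω : BondConfig (Fin n) |
        1 ≤ (A.filter fun z => ω ∈ openConn o z).card ∧ (A.filter fun z => ω ∈ openConn o z).card ≤ j} ≤
      ∑ b ∈ A, (prodBernoulli v).real {ω : BondConfig (Fin n) |
          b ∈ (A.filter fun b' => ω ∈ openConnIn ((↑A : Set (Fin n))ᶜ ∪ {b'}) o b') ∧
          ∀ b' ∈ A, r b' < r b → b' ∉ (A.filter fun b'' => ω ∈ openConnIn ((↑A : Set (Fin n))ᶜ ∪ {b''}) o b'')} *
        (prodBernoulli v).real {ω : BondConfig (Fin n) | (A.filter fun z => ω ∈ openConn b z).card ≤ j} := by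
  set Sel : Fin n → Set (BondConfig (Fin n)) := fun b => {ω |
    b ∈ (A.filter fun b' => ω ∈ openConnIn ((↑A : Set (Fin n))ᶜ ∪ {b'}) o b') ∧
    ∀ b' ∈ A, r b' < r b → b' ∉ (A.filter fun b'' => ω ∈ openConnIn ((↑A : Set (Fin n))ᶜ ∪ {b''}) o b'')} with hSel
  set R : Fin n → Set (BondConfig (Fin n)) := fun b => {ω | (A.filter fun z => ω ∈ openConn b z).card ≤ j} with hR
  set L : Set (BondConfig (Fin n)) := {ω | 1 ≤ (A.filter fun z => ω ∈ openConn o z).card ∧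
    (A.filter fun z => ω ∈ openConn o z).card ≤ j} with hL
  set Φ : (Sym2 (Fin n) → unitInterval) → ℝ :=
    fun w => ∑ b ∈ A, (prodBernoulli w).real (Sel b) * (prodBernoulli w).real (R b) - (prodBernoulli w).real L with hΦ
  suffices H : ∀ (k : ℕ) (w : Sym2 (Fin n) → unitInterval),
      (Finset.univ.filter fun y : Fin n => y ≠ o ∧ w s(o, y) ≠ 0).card = k →
      (∀ e : Sym2 (Fin n), o ∉ e → w e = v e) → 0 ≤ Φ w by
    have h := H _ v rfl (fun e _ => rfl)
    change (prodBernoulli v).real L ≤ ∑ b ∈ A, (prodBernoulli v).real (Sel b) * (prodBernoulli v).real (R b)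
    have : Φ v = ∑ b ∈ A, (prodBernoulli v).real (Sel b) * (prodBernoulli v).real (R b) - (prodBernoulli v).real L := rfl
    linarith
  have hagree : ∀ (w : Sym2 (Fin n) → unitInterval) (y : Fin n) (t : unitInterval),
      (∀ e : Sym2 (Fin n), o ∉ e → w e = v e) → ∀ e : Sym2 (Fin n), o ∉ e → Function.update w s(o, y) t e = v e := by
    intro w y t hw e he
    have hne : e ≠ s(o, y) := fun h => he (h ▸ Sym2.mem_mk_left o y)
    rw [Function.update_of_ne hne]; exact hw e he
  have hcount : ∀ (w : Sym2 (Fin n) → unitInterval) (y : Fin n), y ≠ o → w s(o, y) ≠ 0 →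
      (Finset.univ.filter fun z : Fin n => z ≠ o ∧ Function.update w s(o, y) 0 s(o, z) ≠ 0).card <
      (Finset.univ.filter fun z : Fin n => z ≠ o ∧ w s(o, z) ≠ 0).card := by
    intro w y hyo hy0
    apply Finset.card_lt_card
    rw [Finset.ssubset_iff_of_subset]
    · refine ⟨y, Finset.mem_filter.2 ⟨Finset.mem_univ _, hyo, hy0⟩, ?_⟩
      intro h
      have h' := (Finset.mem_filter.1 h).2.2
      rw [Function.update_self] at h'
      exact h' rfl
    · intro z hz
      have hz' := (Finset.mem_filter.1 hz).2
      refine Finset.mem_filter.2 ⟨Finset.mem_univ _, hz'.1, ?_⟩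
      by_cases hzf : s(o, z) = s(o, y)
      · rw [hzf, Function.update_self] at hz'
        exact absurd rfl hz'.2
      · have h2 := hz'.2
        rwa [Function.update_of_ne hzf] at h2
  intro k
  induction k using Nat.strong_induction_on with
  | _ k ih =>
  intro w hk hw
  have hres : (fun e : Sym2 (Fin n) => if e ∈ {e : Sym2 (Fin n) | o ∉ e} then w e else 0) =
      fun e : Sym2 (Fin n) => if e ∈ {e : Sym2 (Fin n) | o ∉ e} then v e else 0 := by
    funext e
    by_cases he : e ∈ {e : Sym2 (Fin n) | o ∉ e}
    · simp only [he, if_true]; exact hw e he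
    · simp only [he, if_false]
  have hcompat_w : ∀ b ∈ A, ∀ b' ∈ A, r b < r b' →
      (prodBernoulli fun e : Sym2 (Fin n) => if e ∈ {e : Sym2 (Fin n) | o ∉ e} then w e else 0).real (R b') ≤
        (prodBernoulli fun e : Sym2 (Fin n) => if e ∈ {e : Sym2 (Fin n) | o ∉ e} then w e else 0).real (R b) := by
    rw [hres]; exact hcompat
  by_cases hnz : ∃ y : Fin n, y ≠ o ∧ w s(o, y) ≠ 0
  · obtain ⟨y, hyo, hy0⟩ := hnz
    have ih0 : 0 ≤ Φ (Function.update w s(o, y) 0) :=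
      ih _ (by rw [← hk]; exact hcount w y hyo hy0) _ rfl (hagree w y 0 hw)
    have h1 : 0 ≤ 1 - (w s(o, y) : ℝ) := sub_nonneg.2 (w s(o, y)).2.2
    have e1 : Φ (Function.update w s(o, y) 0) =
        ∑ b ∈ A, (prodBernoulli (Function.update w s(o, y) 0)).real (Sel b) *
          (prodBernoulli (Function.update w s(o, y) 0)).real (R b) - (prodBernoulli (Function.update w s(o, y) 0)).real L := rfl
    have e3 : Φ w = ∑ b ∈ A, (prodBernoulli w).real (Sel b) * (prodBernoulli w).real (R b) - (prodBernoulli w).real L := rfl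
    by_cases hyA : y ∈ A
    · -- a coin: the one-coin step (Lemma M + TOP'')
      have hstep : (1 - (w s(o, y) : ℝ)) * Φ (Function.update w s(o, y) 0) ≤ Φ w :=
        coinStep w A j r hr hoA hyA hcompat_w
      nlinarith [mul_nonneg h1 ih0]
    · -- a free pair: the peeling hypothesis
      have hstep := hpeel w y hw hyo hyA hy0
      rw [← e1, ← e3] at hstep
      nlinarith [mul_nonneg h1 ih0]
  · -- base: the observer is isolated, `μ(L) = 0`
    push Not at hnz
    have hzero : ∀ y : Fin n, y ≠ o → ((w s(o, y) : unitInterval) : ℝ) = 0 := by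
      intro y hyo
      rw [hnz y hyo]; rfl
    have hL0 : (prodBernoulli w).real L = 0 := MergeStability.real_L_eq_zero_of_isolated w A o j hoA hzero
    change 0 ≤ ∑ b ∈ A, (prodBernoulli w).real (Sel b) * (prodBernoulli w).real (R b) - (prodBernoulli w).real L
    rw [hL0, sub_zero]
    exact Finset.sum_nonneg fun b _ => mul_nonneg measureReal_nonneg measureReal_nonneg

/-- **Typed target: free-edge peeling ⇒ `NoHeavyLowerTail`.**  Hypothesis (FP): for every weighted graph on `Fin n`, relays `A`,
observer `o ∉ A`, level `j`, injective `H`-compatible ranking `r`, and every non-relay `y ≠ o` with `w s(o,y) ≠ 0`: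
`(1 − w s(o,y))·Φ_r(w[s(o,y) ↦ 0]) ≤ Φ_r(w)`.  Conclusion: the crux, through `patternLightest_of_freePeel`, `sum_sel_eq_sum_patterns`,
`exists_compatible_ranking` and `PatternLightest.noHeavyLowerTail_of_patternLightest`.  ((FP) is census-clean and open; it is implied by
the glue-step `(B*)` together with positivity for the once-glued observer; memo PROOF-COIN-REDUCTION.md §11.) [folklore — reduction only] -/
theorem noHeavyLowerTail_of_freePeel
    (hFP : ∀ (n : ℕ) (w : Sym2 (Fin n) → unitInterval) (A : Finset (Fin n)) (o y : Fin n) (j : ℕ) (r : Fin n → ℕ),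
      o ∉ A → Set.InjOn r ↑A →
      (∀ b ∈ A, ∀ b' ∈ A, r b < r b' →
        (Literature.Probability.LatticeModels.prodBernoulli fun e : Sym2 (Fin n) =>
            if e ∈ {e : Sym2 (Fin n) | o ∉ e} then w e else 0).real
            {ω : Literature.Probability.Percolation.BondConfig (Fin n) |
              (A.filter fun z => ω ∈ Literature.Probability.Percolation.openConn b' z).card ≤ j} ≤
          (Literature.Probability.LatticeModels.prodBernoulli fun e : Sym2 (Fin n) =>
            if e ∈ {e : Sym2 (Fin n) | o ∉ e} then w e else 0).real
            {ω : Literature.Probability.Percolation.BondConfig (Fin n) |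
              (A.filter fun z => ω ∈ Literature.Probability.Percolation.openConn b z).card ≤ j}) →
      y ≠ o → y ∉ A → w s(o, y) ≠ 0 →
      (1 - (w s(o, y) : ℝ)) *
          (∑ b ∈ A, (Literature.Probability.LatticeModels.prodBernoulli (Function.update w s(o, y) 0)).real
              {ω : Literature.Probability.Percolation.BondConfig (Fin n) |
                b ∈ (A.filter fun b' => ω ∈ Literature.Probability.Percolation.openConnIn ((↑A : Set (Fin n))ᶜ ∪ {b'}) o b') ∧
                ∀ b' ∈ A, r b' < r b →
                  b' ∉ (A.filter fun b'' => ω ∈ Literature.Probability.Percolation.openConnIn ((↑A : Set (Fin n))ᶜ ∪ {b''}) o b'')} *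
            (Literature.Probability.LatticeModels.prodBernoulli (Function.update w s(o, y) 0)).real
              {ω : Literature.Probability.Percolation.BondConfig (Fin n) |
                (A.filter fun z => ω ∈ Literature.Probability.Percolation.openConn b z).card ≤ j} -
          (Literature.Probability.LatticeModels.prodBernoulli (Function.update w s(o, y) 0)).real
            {ω : Literature.Probability.Percolation.BondConfig (Fin n) |
              1 ≤ (A.filter fun z => ω ∈ Literature.Probability.Percolation.openConn o z).card ∧
              (A.filter fun z => ω ∈ Literature.Probability.Percolation.openConn o z).card ≤ j}) ≤
        ∑ b ∈ A, (Literature.Probability.LatticeModels.prodBernoulli w).real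
            {ω : Literature.Probability.Percolation.BondConfig (Fin n) |
              b ∈ (A.filter fun b' => ω ∈ Literature.Probability.Percolation.openConnIn ((↑A : Set (Fin n))ᶜ ∪ {b'}) o b') ∧
              ∀ b' ∈ A, r b' < r b →
                b' ∉ (A.filter fun b'' => ω ∈ Literature.Probability.Percolation.openConnIn ((↑A : Set (Fin n))ᶜ ∪ {b''}) o b'')} *
          (Literature.Probability.LatticeModels.prodBernoulli w).real
            {ω : Literature.Probability.Percolation.BondConfig (Fin n) |
              (A.filter fun z => ω ∈ Literature.Probability.Percolation.openConn b z).card ≤ j} -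
        (Literature.Probability.LatticeModels.prodBernoulli w).real
          {ω : Literature.Probability.Percolation.BondConfig (Fin n) |
            1 ≤ (A.filter fun z => ω ∈ Literature.Probability.Percolation.openConn o z).card ∧
            (A.filter fun z => ω ∈ Literature.Probability.Percolation.openConn o z).card ≤ j}) :
    Summit.CriticalPhenomena.PercolationContinuityZ3.Theses.PercNearOneGluing.NoHeavyLowerTail := by
  apply PatternLightest.noHeavyLowerTail_of_patternLightest
  intro n w A o j hoA
  obtain ⟨r, hr, hcompat⟩ := exists_compatible_ranking
    (fun b => (prodBernoulli fun e : Sym2 (Fin n) => if e ∈ {e : Sym2 (Fin n) | o ∉ e} then w e else 0).real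
      {ω : BondConfig (Fin n) | (A.filter fun z => ω ∈ openConn b z).card ≤ j}) A
  have hex : ∀ B : Finset (Fin n), B.Nonempty → ∃ b ∈ B, ∀ b' ∈ B, r b ≤ r b' :=
    fun B hB => Finset.exists_min_image B r hB
  set sel : Finset (Fin n) → Fin n := fun B => if h : B.Nonempty then Classical.choose (hex B h) else o with hseldef
  have hsel : ∀ B : Finset (Fin n), B.Nonempty → sel B ∈ B ∧ ∀ b ∈ B, r (sel B) ≤ r b := by
    intro B hB
    have h := Classical.choose_spec (hex B hB)
    simp only [hseldef, dif_pos hB]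
    exact ⟨h.1, h.2⟩
  refine ⟨sel, fun B hB => (hsel B (Finset.nonempty_iff_ne_empty.2 (Finset.ne_of_mem_erase hB))).1, ?_⟩
  have key := sum_sel_eq_sum_patterns (prodBernoulli w) A o r hr sel hsel
    (fun b => (prodBernoulli w).real {ω : BondConfig (Fin n) | (A.filter fun x => ω ∈ openConn b x).card ≤ j})
  rw [← key]
  have hres : ∀ w' : Sym2 (Fin n) → unitInterval, (∀ e : Sym2 (Fin n), o ∉ e → w' e = w e) →
      (fun e : Sym2 (Fin n) => if e ∈ {e : Sym2 (Fin n) | o ∉ e} then w' e else 0) =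
        fun e : Sym2 (Fin n) => if e ∈ {e : Sym2 (Fin n) | o ∉ e} then w e else 0 := by
    intro w' hw'
    funext e
    by_cases he : e ∈ {e : Sym2 (Fin n) | o ∉ e}
    · simp only [he, if_true]; exact hw' e he
    · simp only [he, if_false]
  apply patternLightest_of_freePeel w A j o r hr hoA hcompat
  intro w' y hw' hyo hyA hwy
  exact hFP n w' A o y j r hoA hr (by rw [hres w' hw']; exact hcompat) hyo hyA hwy

end CoinReduction

end Summit.CriticalPhenomena.PercolationContinuityZ3.Theorems

end
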